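import Mathlib

/-!
# Stub `stub_normDetChainBlock` of line `Sketch` (idea `free-tangent-landau-chessboard`)
(crux `Summit.QuantumFields.QCD.Theses.QuarksAsStableAction.WilsonQuarkStability`, item stmt-QuantumFields-9736,
route route-QuantumFields-QuarksAsStableAction)

**`|det E_t|` is blind to the temporal links.**  In Lüscher's transfer-matrix form of the Wilson determinant the
chain blocks are `E = A P⁻ − P⁺ W` with `P⁺, P⁻` complementary projections (`P⁺ + P⁻ = 1`, `P⁺ P⁻ = P⁻ P⁺ = 0`,
both Hermitian) and `W` a unitary commuting with `P⁺` and `P⁻` (the temporal transporter, colour ⊗ 1_spin).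
We prove `‖det (A P⁻ − P⁺ W)‖ = ‖det (A P⁻ − P⁺)‖`.

Proof (pure linear algebra).  Factor `A P⁻ − P⁺ W = (A P⁻ − P⁺) (P⁻ + W P⁺)` (expand, using `P⁻ P⁻ = P⁻`,
`P⁺ P⁺ = P⁺`, `P⁻ P⁺ = P⁺ P⁻ = 0` and that `W` commutes with `P±`).  The second factor `V := P⁻ + W P⁺` is unitary:
`V Vᴴ = (P⁻ + W P⁺)(P⁻ + P⁺ Wᴴ) = P⁻ + 0 + 0 + P⁺ W Wᴴ = P⁻ + P⁺ = 1`, hence `‖det V‖ = 1`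
(`Matrix.det_of_mem_unitary`, `CStarRing.norm_of_mem_unitary`), and `det` is multiplicative.

Pure theorem file (Mathlib only, no `def`s).
-/

namespace Summit.QuantumFields.QCD.Cruxes.WilsonQuarkStability.FreeTangentLandauChessboard

open Matrix

/-- A complementary pair `Pp + Pm = 1` with `Pp * Pm = 0` consists of idempotents: `Pp * Pp = Pp`. -/
theorem normDetChainBlock_idem_left {k : Type} [Fintype k] [DecidableEq k] (Pp Pm : Matrix k k ℂ)
    (hP : Pp + Pm = 1) (hPQ : Pp * Pm = 0) : Pp * Pp = Pp := by
  have h := congrArg (fun X => Pp * X) hP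
  simp only [Matrix.mul_add, Matrix.mul_one, hPQ, add_zero] at h
  exact h

/-- A complementary pair `Pp + Pm = 1` with `Pp * Pm = 0` consists of idempotents: `Pm * Pm = Pm`. -/
theorem normDetChainBlock_idem_right {k : Type} [Fintype k] [DecidableEq k] (Pp Pm : Matrix k k ℂ)
    (hP : Pp + Pm = 1) (hPQ : Pp * Pm = 0) : Pm * Pm = Pm := by
  have h := congrArg (fun X => X * Pm) hP
  simp only [Matrix.add_mul, Matrix.one_mul, hPQ, zero_add] at h
  exact h

/-- The factorisation `A Pm − Pp W = (A Pm − Pp) (Pm + W Pp)` of a chain block. -/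
theorem normDetChainBlock_factor {k : Type} [Fintype k] [DecidableEq k] (A Pp Pm W : Matrix k k ℂ)
    (hP : Pp + Pm = 1) (hPQ : Pp * Pm = 0) (hQP : Pm * Pp = 0)
    (hWp : W * Pp = Pp * W) (hWm : W * Pm = Pm * W) :
    A * Pm - Pp * W = (A * Pm - Pp) * (Pm + W * Pp) := by
  have hPp2 : Pp * Pp = Pp := normDetChainBlock_idem_left Pp Pm hP hPQ
  have hPm2 : Pm * Pm = Pm := normDetChainBlock_idem_right Pp Pm hP hPQ
  have h1 : A * Pm * Pm = A * Pm := by rw [Matrix.mul_assoc, hPm2]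
  have h2 : A * Pm * (W * Pp) = 0 := by
    rw [Matrix.mul_assoc, ← Matrix.mul_assoc Pm W Pp, ← hWm, Matrix.mul_assoc W Pm Pp, hQP,
      Matrix.mul_zero, Matrix.mul_zero]
  have h3 : Pp * (W * Pp) = Pp * W := by
    rw [← Matrix.mul_assoc, ← hWp, Matrix.mul_assoc, hPp2]
  rw [Matrix.sub_mul, Matrix.mul_add, Matrix.mul_add, h1, h2, hPQ, h3, add_zero, zero_add]

/-- The second factor `Pm + W Pp` is unitary when `Pp, Pm` are complementary Hermitian projections and `W` is a
unitary commuting with `Pp`. -/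
theorem normDetChainBlock_factor_mem_unitaryGroup {k : Type} [Fintype k] [DecidableEq k]
    (Pp Pm W : Matrix k k ℂ)
    (hP : Pp + Pm = 1) (hPQ : Pp * Pm = 0) (hQP : Pm * Pp = 0) (hPph : Ppᴴ = Pp) (hPmh : Pmᴴ = Pm)
    (hW : W ∈ Matrix.unitaryGroup k ℂ) (hWp : W * Pp = Pp * W) :
    Pm + W * Pp ∈ Matrix.unitaryGroup k ℂ := by
  have hPp2 : Pp * Pp = Pp := normDetChainBlock_idem_left Pp Pm hP hPQ
  have hPm2 : Pm * Pm = Pm := normDetChainBlock_idem_right Pp Pm hP hPQ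
  have hWW : W * Wᴴ = 1 := by
    have h := Matrix.mem_unitaryGroup_iff.mp hW
    rwa [star_eq_conjTranspose] at h
  rw [Matrix.mem_unitaryGroup_iff, star_eq_conjTranspose, conjTranspose_add, conjTranspose_mul, hPmh, hPph,
    Matrix.mul_add, Matrix.add_mul, Matrix.add_mul, hPm2, Matrix.mul_assoc W Pp Pm, hPQ, Matrix.mul_zero,
    add_zero, ← Matrix.mul_assoc Pm Pp Wᴴ, hQP, Matrix.zero_mul, zero_add, Matrix.mul_assoc W Pp (Pp * Wᴴ),
    ← Matrix.mul_assoc Pp Pp Wᴴ, hPp2, ← Matrix.mul_assoc W Pp Wᴴ, hWp, Matrix.mul_assoc, hWW,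
    Matrix.mul_one, add_comm, hP]

/-- **Stub `stub_normDetChainBlock`**: the modulus of the determinant of a chain block `A P⁻ − P⁺ W` does not
depend on the unitary `W` commuting with the complementary Hermitian projections `P⁺, P⁻`:
`‖det (A P⁻ − P⁺ W)‖ = ‖det (A P⁻ − P⁺)‖`. -/
theorem stub_normDetChainBlock {k : Type} [Fintype k] [DecidableEq k] (A Pp Pm W : Matrix k k ℂ)
    (hP : Pp + Pm = 1) (hPQ : Pp * Pm = 0) (hQP : Pm * Pp = 0) (hPph : Ppᴴ = Pp) (hPmh : Pmᴴ = Pm)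
    (hW : W ∈ Matrix.unitaryGroup k ℂ) (hWp : W * Pp = Pp * W) (hWm : W * Pm = Pm * W) :
    ‖(A * Pm - Pp * W).det‖ = ‖(A * Pm - Pp).det‖ := by
  have hV : Pm + W * Pp ∈ Matrix.unitaryGroup k ℂ :=
    normDetChainBlock_factor_mem_unitaryGroup Pp Pm W hP hPQ hQP hPph hPmh hW hWp
  have hdetV : ‖(Pm + W * Pp).det‖ = 1 :=
    CStarRing.norm_of_mem_unitary (Matrix.det_of_mem_unitary hV)
  rw [normDetChainBlock_factor A Pp Pm W hP hPQ hQP hWp hWm, Matrix.det_mul, norm_mul, hdetV, mul_one]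

end Summit.QuantumFields.QCD.Cruxes.WilsonQuarkStability.FreeTangentLandauChessboard
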